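import Mathlib.Geometry.Manifold.ContMDiffMFDeriv
import Mathlib.Geometry.Manifold.Instances.Sphere
import Mathlib.Topology.Homotopy.Equiv
import Literature.Geometry.Symplectic.StandardEnd
import HarnessLib

/-!
# The tangent bundle of a homotopy 4-sphere has the clutching class of `TS⁴` (frame form)

Topic `Literature/Topology/FourManifolds`. ONE named fact (no proofs here), requested by route
`SmoothPoincare4/SullivanDual` (support item `AdmissibleJExists`, stmt-SmoothPoincare4-7830, whose
conditional closure `Summit.SmoothPoincare4.SmoothPoincare4.Theorems.SullivanDual.admissibleJExists_of_tangentFrame`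
consumes it, and whose companion theorem
`….tangentFrame_invertedChart_of_nonempty_diffeomorph_sphere` PROVES its conclusion for every
smooth 4-manifold diffeomorphic to `S⁴`):

* `Literature.Topology.FourManifolds.tangentFrame_homotopySphereFour_eq_invertedChartFrame` — for a
  closed smooth 4-manifold `M ≃ₕ S⁴` and `q ∈ M`, the tangent bundle of `M ∖ {q}` admits a smooth
  global frame which, on a punctured chart-ball at `q`, is the coordinate frame of the inverted
  recentred chart `ι ∘ (e − e q)` (`e = extChartAt q`, `ι(z) = z/‖z‖²`). Classically: `TM` has the
  clutching (characteristic) class of `TS⁴` — `TM ≅ c^*TS⁴` for the degree-one collapse — because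
  oriented 4-plane bundles over a 4-complex are classified by `(w₂, p₁, e)` (Dold–Whitney 1959;
  over `S⁴`: Milnor 1956, §3), `e[M] = χ(M) = 2`, and `p₁[M] = 0` since homotopy spheres are
  s-parallelisable (Kervaire–Milnor 1963, Thm. 3.1; Hirzebruch's signature theorem), exactly as
  for `S⁴`, whose clutching function with respect to the stereographic charts is the differential
  of the inversion, `Dι(z) = ‖z‖⁻²·(reflection in z^⊥)` (Steenrod 1951, §23, §27).

Vocabulary: the punctured manifold `Literature.Geometry.Symplectic.punctured q` (an `Opens`, with
Mathlib's open-submanifold structure), the punctured chart-ball predicate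
`Literature.Geometry.Symplectic.InPuncturedChartBall`, the inversion
`Literature.Geometry.Symplectic.inversion` (all from `Geometry/Symplectic/StandardEnd.lean`); frames
are `C^∞` sections of the tangent bundle (`ContMDiff … (𝓡 4).tangent`) forming a basis pointwise.

What the tree already PROVES towards it: `TM` is (continuously) framed over `M ∖ {q}`
(`hasTangentFramingAlong_compl_singleton_of_homotopyEquiv_sphere_four`,
`TangentFrameCoveringHomotopy.lean`); what is missing is the identification of the clutching class
(characteristic classes `e`, `p₁` of real 4-plane bundles and `π₃(SO(4)) ≅ ℤ ⊕ ℤ` have no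
vocabulary in Mathlib or the tree). A finer classical decomposition: Kervaire–Milnor 3.1 (the
clutching map is stably trivial) + Poincaré–Hopf on `M` (the degree of its first column is
`χ(M) = 2`) + Steenrod §22–23 (`ker(π₃SO(4) → π₃SO(5)) = ℤ·∂ι₄` is detected by that degree).

## References

* A. Dold, H. Whitney, *Classification of oriented sphere bundles over a 4-complex*, Ann. of
  Math. 69 (1959), 667–677, Thms. 1–2. [DoldWhitney1959]
* M. Kervaire, J. Milnor, *Groups of homotopy spheres I*, Ann. of Math. 77 (1963), Thm. 3.1
  (p. 508). [KervaireMilnorAnnals1963]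
* J. Milnor, *On manifolds homeomorphic to the 7-sphere*, Ann. of Math. 64 (1956), §3.
  [MilnorAnnals1956]
* N. Steenrod, *The Topology of Fibre Bundles* (1951), §6.7, §18, §23, §27. [Steenrod1951]
* A. Kosinski, *Differential Manifolds* (1993), IX §8. [Kosinski1993]
-/

open scoped Manifold ContDiff ContinuousMap

namespace Literature.Topology.FourManifolds

/-- **The tangent bundle of a homotopy 4-sphere is framed off a point by a frame which, near
the point, is the coordinate frame of the inverted chart** (equivalently: `TΣ⁴` has the
clutching class of `TS⁴`; equivalently `TΣ ≅ c^*TS⁴` for the degree-one collapse `c : Σ → S⁴`).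

Statement (Lean reading). For every Hausdorff second-countable `C^∞` 4-manifold `M` homotopy
equivalent to `S⁴` and every `q ∈ M`, with `e = extChartAt q` the preferred chart and
`ι(z) = z/‖z‖²` the inversion (`Literature.Geometry.Symplectic.inversion`), there are `ε > 0` and
`C^∞` vector fields `s₀, …, s₃` on `M ∖ {q}` (the open submanifold
`Literature.Geometry.Symplectic.punctured q`; smoothness as sections of its tangent bundle) forming
a basis of the tangent space at every point, such that on the punctured chart-ball of radius `ε`
(`InPuncturedChartBall q ε`) they are the coordinate vector fields of the inverted recentred chart
`ι ∘ (e − e q)`: `d(ι ∘ (e − e q))_x (sᵢ x) = eᵢ`, i.e. `Dι(e x − e q) (De_x (sᵢ x)) = eᵢ`.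

Why it is true (classical; not formalised). `M` is compact and `M ∖ {q}` is contractible, so
`TM` is trivial over `M ∖ {q}` (Steenrod 1951, §11.6; in the tree this much is PROVED,
`Literature.Topology.FourManifolds.hasTangentFramingAlong_compl_singleton_of_homotopyEquiv_sphere_four`).
Comparing such a framing with the chart framing at `q` on a small sphere around `q` gives the
clutching (characteristic) map `γ : S³ → GL₄(ℝ)` of `TM` (Steenrod 1951, §18; Kosinski 1993,
IX §8: `TM = c^*ξ(γ)` for the collapse `c : M → S⁴` of degree one), whose class in
`π₃(SO(4)) ≅ ℤ ⊕ ℤ` is detected by the Euler number and the Pontryagin number of `ξ(γ)`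
(Milnor 1956, §3: `e(ξ_{h,j}) = h + j`, `p₁(ξ_{h,j}) = ±2(h − j)`; Dold–Whitney 1959: oriented
4-plane bundles over a 4-complex are classified by `w₂, e, p₁`). Here `e[M] = χ(M) = 2` and
`p₁[M] = 0` — `M` is s-parallelisable (Kervaire–Milnor 1963, Thm. 3.1, Case 2: Hirzebruch's
signature theorem, `p₁ = 3σ = 0`) — exactly as for `S⁴`, whose clutching function with respect to
its two stereographic charts is `z ↦ Dι(z) = ‖z‖⁻² · (reflection in z^⊥)` (Steenrod 1951,
§23.3–23.4 and §27: the characteristic map `T_{n+1}` by reflections and the tangent bundle of `Sⁿ`). Hence the frame `x ↦ (d(ι ∘ (e − e q))_x)⁻¹ eᵢ`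
on a punctured chart-ball, whose clutching map against the chart frame is `Dι`, extends to a
continuous — and then, by smoothing (Steenrod 1951, §6.7), to a smooth — global frame of
`T(M ∖ {q})`. For `M ≅ S⁴` the inverted chart extends to a diffeomorphism `M ∖ {q} ≅ ℝ⁴`
(Palais; in the tree `Literature.Geometry.Symplectic.palais_puncturedSphere_chartForm_holds`) and
the frame is its coordinate frame (PROVED for every such `M`, at every point:
`Summit.SmoothPoincare4.SmoothPoincare4.Theorems.SullivanDual.tangentFrame_invertedChart_of_nonempty_diffeomorph_sphere`,
so the fact follows from "every homotopy 4-sphere is diffeomorphic to `S⁴`").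
-- TODO(general form): Dold–Whitney's classification of oriented 4-plane bundles over a
-- 4-complex by `(w₂, p₁, e)` and Kosinski IX (8.2)–(8.4) for almost-parallelisable manifolds,
-- of which this is the instance `TΣ⁴ ≅ c^*TS⁴`; the tree has no characteristic classes of real
-- vector bundles yet.
[cite: DoldWhitney1959, Thm. 1–2 (classification of SO(4)-bundles over a 4-complex by w₂, p₁, e)]
[cite: KervaireMilnorAnnals1963, Thm. 3.1 (p. 508): homotopy spheres are s-parallelizable]
[cite: MilnorAnnals1956, §3 (4-plane bundles ξ_{h,j} over S⁴: e = h + j, p₁ = ±2(h − j))]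
[cite: Steenrod1951, §18 (classification of bundles over Sⁿ by characteristic maps), §23.3–23.4 and §27 (the characteristic map by reflections; the tangent bundle of Sⁿ), §6.7 (smoothing cross-sections)]
[cite: Kosinski1993, IX §8, (8.1)–(8.4) (almost parallelizable manifolds: TM = c^*ξ(γ))]
-/
def tangentFrame_homotopySphereFour_eq_invertedChartFrame : Prop :=
  ∀ (M : Type) [TopologicalSpace M] [T2Space M] [SecondCountableTopology M]
    [ChartedSpace (EuclideanSpace ℝ (Fin 4)) M] [IsManifold (𝓡 4) ∞ M],
    M ≃ₕ Metric.sphere (0 : EuclideanSpace ℝ (Fin 5)) 1 → ∀ q : M,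
    ∃ (ε : ℝ) (s : Fin 4 → ∀ x : Literature.Geometry.Symplectic.punctured q, TangentSpace (𝓡 4) x),
      0 < ε ∧
      (∀ i, ContMDiff (𝓡 4) (𝓡 4).tangent ∞ fun x : Literature.Geometry.Symplectic.punctured q =>
        (Bundle.TotalSpace.mk' (EuclideanSpace ℝ (Fin 4)) x (s i x) :
          TangentBundle (𝓡 4) (Literature.Geometry.Symplectic.punctured q))) ∧
      (∀ x, LinearIndependent ℝ fun i => s i x) ∧
      ∀ x, Literature.Geometry.Symplectic.InPuncturedChartBall q ε x → ∀ i,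
        fderiv ℝ Literature.Geometry.Symplectic.inversion
            (extChartAt (𝓡 4) q x.1 - extChartAt (𝓡 4) q q)
          (mfderiv (𝓡 4) 𝓘(ℝ, EuclideanSpace ℝ (Fin 4))
            (fun z : Literature.Geometry.Symplectic.punctured q => extChartAt (𝓡 4) q z.1) x
            (s i x)) = EuclideanSpace.single i 1

end Literature.Topology.FourManifolds
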